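import Literature.MathematicalPhysics.QuantumLattice.DWaveSourceTIClassWindowCertificate
import Literature.MathematicalPhysics.QuantumLattice.PairSourceWindowLocalHamiltonian
import Literature.MathematicalPhysics.QuantumLattice.DWaveOrderParameterInfiniteVolume
import HarnessLib

/-!
# Pair-sourced `t–t'` window certificates WITH ground-state rows (`eom`, `kkt`), read in the CLASS OF ALL
# TRANSLATION-INVARIANT GROUND STATES of the sourced model: state-free floors on `E(h)`, `−∂⁻E(h)`, `−∂⁺E(h)`

Topic `Literature/MathematicalPhysics/QuantumLattice` (namespace = path); cell `hubbard-cq`, seat `hubbard-cq-obsth-1`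
(row «pinning-field K5 menu nodes with the pinning term»). Companion of `DWaveSourceTIClassWindowCertificate` (the reader of a
sourced gbT certificate WITHOUT ground-state rows, valid for every translation-invariant state) and of the torus readers
`DWaveSourceNNNHoppingTwistedFlipWindowCertificateKKT` (the same identity WITH `eom` / `kkt` rows, valid in ground-state
VECTORS of finite tori). Here the identity WITH ground-state rows is read in the infinite-volume ground-state class:

  `Xw − c·1 − Σ_σ μ_σ (n_{0σ} − ν·1) − κ⁺ (u·1 − Γ E^{src}_h) − κ⁻ (Γ E^{tt'} − ℓ·1)
     = gramForm Λm O + (Σ_{k∈s} (H^{src,tt'}_{Λ'} B̃ₖ − B̃ₖ H^{src,tt'}_{Λ'}) + Σₗ bbₗ • (φₗ • Γ(Γ(d4Emb γₗ wₗ Λ)(F^{fₗ} Wₗ)) − Γ Wₗ))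
       + (Σₘ dₘ (Vₘᴴ − Vₘ) + Σₖ aₖ Wₖ) + kktForm H^{src,tt'}_{Λ'} G B̃k`

(`H^{src,tt'}_{Λ'} = pairSourceWindowHamiltonianTT' dWaveFormFactor Λ' t' U μ h` — the SAME window Hamiltonian as in the torus
readers, = the local Hamiltonian of `hubbardTTPrimeSourcedInteraction 1 t' U μ dWaveFormFactor h` by
`pairSourceWindowHamiltonianTT'_dWave_eq_localHamiltonian`; `Λm, G ⪰ 0`; `Bₖ, Bk_b ∈ 𝔄_Λ` ARBITRARY — charged, odd, …: the
sourced model conserves no particle number —; `thicken Λ 1 ⊆ Λ'`). THE CLASS: translation-invariant minimisers `ω` of the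
sourced mean energy `e^{src}_{μ,h}` (`IsMeanEnergyMinimiser`; for translation-invariant states these are exactly the
Bratteli–Kishimoto–Robinson ground states, tree `isMeanEnergyMinimiser_iff_isGroundState`; every torus limit of sourced
ground-state vectors is one, `IsTorusLimitOf.isMeanEnergyMinimiser_sourced`). On this class the `eom` block has
expectation `0` and the `kkt` block `≥ 0` (`PairSourceWindowLocalHamiltonian` §4), the class is stable under the 32
flip-twisted transforms (`IsMeanEnergyMinimiser.twistedFlipAct`), and the sourced energy is the STATE-FREE number
`e^{src}(ω) = E(h) = dWaveSourceEnergyDensityTT' t' U μ h` — so a cap row is discharged by a certified `E(h) ≤ u`.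

* §1 `IsMeanEnergyMinimiser.re_sum_twistedFlipAct_expect_ge_of_sourced_certificate_kkt` — the orbit form:
  `c − Σ‖aₖ‖ + (Σ_σ μ_σ)(ρ(ω)/2 − ν) ≤ (1/32) Σ_g Re (α_g ω)(Xw)` for every translation-invariant ground state `ω`
  (reduction: move the ground-state blocks into the objective and read `DWaveSourceTIClassWindowCertificate` §2).
* §2 node shapes on the class: ENERGY `… ≤ e^{src}_h(ω)`; PAIR MAX `2 Re ω(P₀^d) ≤ −(…)`; PAIR MIN `… ≤ 2 Re ω(P₀^d)`;
  `IsMeanEnergyMinimiser.mul_meanEnergy_sourced_le_of_le` (cap-row discharge from `E(h) ≤ u`).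
* §3 STATE-FREE SENTENCES (grand-canonical shapes: no filling rows): an energy certificate with ground-state rows proves
  `c − Σ‖aₖ‖ ≤ E(h)` (`dWaveSourceEnergyDensityTT'_ge_of_gs_certificate_kkt` — the minimum IS attained in the class); a
  pair-amplitude MIN certificate with a cap row (`κ⁺ ≥ 0`, certified `E(h) ≤ u`) proves
  `c − Σ‖aₖ‖ ≤ −∂⁻E(h)` (`neg_leftDeriv_dWaveSourceEnergyDensityTT'_ge_of_gs_certificate_kkt`), a MAX certificate proves
  `−∂⁺E(h) ≤ −(c − Σ‖aₖ‖)` (`neg_rightDeriv_dWaveSourceEnergyDensityTT'_le_of_gs_certificate_kkt`): both ends of Griffiths'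
  interval `[−∂⁻E(h), −∂⁺E(h)] = {2 Re ω(P₀^d) : ω in the class}` are attained (`DWaveOrderParameterInfiniteVolume`).

HONEST FRAMING (cell hubbard-cq): soundness theorems; no certificate, no number, no order parameter, no phase word — a bound on
`−∂^±E(h)` at a FIXED `h > 0` is a finite-field response (cell wording W1); `m⋆ = −∂⁺E(0)/2` is not touched. Ground-state
rows are licensed ONLY on the ground-state class (never on «every translation-invariant state»; census (38) of the cell: the
pair-amplitude MIN program is informative only with such rows). NOT covered: `S^z`-charged word rows. Everything is PROVED;
no definition, no named fact, no `sorry`. Tree search: `lean search 'gs_certificate_kkt|GSClass'` — nothing; REUSED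
`re_sum_twistedFlipAct_expect_ge_of_sourced_certificate`, `IsMeanEnergyMinimiser.twistedFlipAct`,
`…expect_sum_commutator_pairSourceWindowHamiltonianTT'_eq_zero`, `…re_expect_kktForm_pairSourceWindowHamiltonianTT'_nonneg`,
`exists_isMeanEnergyMinimiser_two_mul_re_expect_localPairAt_eq_neg_leftDeriv / _rightDeriv`, `tiGroundEnergyDensity_dWaveSourced_eq`.

References: J. Wang et al., PRX 14 (2024) 031006, §III (energy-constrained relaxations; ground-state optimality rows)
[cite: WangEtAl2024, §III]; M. Araújo et al., arXiv:2311.18707, §3.2 Prop. 11 (state optimality) [cite: AraujoEtAl2023, §3.2 Prop. 11];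
O. Bratteli, A. Kishimoto, D. W. Robinson, Commun. Math. Phys. 64 (1978) 41, Thm. 2 [cite: BratteliKishimotoRobinson1978, Thm. 2];
R. B. Griffiths, Phys. Rev. 152 (1966) 240, §II [cite: Griffiths1966, §II]; T. Koma, H. Tasaki, J. Stat. Phys. 76 (1994) 745, §1
[cite: KomaTasaki1994, §1]; X. Han, arXiv:2006.06002 §3 (symmetry reduction) [cite: Han2020Bootstrap, §3].
-/

noncomputable section

namespace Literature.MathematicalPhysics.QuantumLattice

open Matrix Finset Complex HubbardWave0 Literature.Probability.LatticeModels Set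
open Literature.MathematicalPhysics.QuantumManyBody.StateRelaxation
open scoped ComplexOrder BigOperators

namespace InfVolFermionState

variable {ω : InfVolFermionState 2} {t' U μ h : ℝ}

/-! ## §1 The orbit form on the ground-state class -/

/-- **Sourced window certificate WITH ground-state rows ⇒ bound on the orbit mean of the objective for EVERY
translation-invariant ground state.** With the identity of the module docstring (`eom` block over `s`, flip-twisted defects
over `tt`, `kkt` block `kktForm H^{src,tt'}_{Λ'} G B̃k`, `Λm, G ⪰ 0`), the cap row discharged on `ω`
(`κ⁺ e^{src}(ω) ≤ κ⁺ u`) and the floor row on the translation-invariant states of density `ρ(ω)`, every translation-invariant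
minimiser `ω` of `e^{src}_{μ,h}` satisfies `c − Σ‖aₖ‖ + (Σ_σ μ_σ)(ρ(ω)/2 − ν) ≤ (1/32) Σ_g Re (α_g ω)_{Λ'}(Xw)`: each `α_g ω` is
again a minimiser, hence a ground state, in which the `eom` block vanishes and the `kkt` block is `≥ 0`; the rest is the
translation-invariant reading. [cite: WangEtAl2024, §III] [cite: AraujoEtAl2023, §3.2 Prop. 11] [cite: BratteliKishimotoRobinson1978, Thm. 2] -/
theorem IsMeanEnergyMinimiser.re_sum_twistedFlipAct_expect_ge_of_sourced_certificate_kkt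
    (hmin : ω.IsMeanEnergyMinimiser (hubbardTTPrimeSourcedInteraction 1 t' U μ dWaveFormFactor h) 1)
    {Λ Λ' : Finset (Site 2)} (hΛ : Λ ⊆ Λ') (h8 : thicken Λ 1 ⊆ Λ') (h0 : thicken ({0} : Finset (Site 2)) 1 ⊆ Λ')
    (hz : (0 : Site 2) ∈ Λ')
    (Xw : FermionOp Λ') (κp κm u lo : ℝ) (μc : Fin 2 → ℝ) (ν : ℝ)
    (hcap : κp * ω.meanEnergy (hubbardTTPrimeSourcedInteraction 1 t' U μ dWaveFormFactor h) 1 ≤ κp * u)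
    (hlo : ∀ σ : InfVolFermionState 2, σ.IsTranslationInvariant → σ.density = ω.density →
      κm * lo ≤ κm * σ.meanEnergy (hubbardTTPrimeFermionInteraction 1 t' U) 1)
    {m : Type*} [Fintype m] [DecidableEq m] {Λm : Matrix m m ℂ} (hΛm : Λm.PosSemidef) (O : m → FermionOp Λ')
    {κ' : Type*} (s : Finset κ') (B : κ' → FermionOp Λ)
    {ι : Type*} (tt : Finset ι) (γ : ι → DihedralGroup 4) (wv : ι → Site 2) (fl mt : ι → Fin 2)
    (hsh : ∀ l, d4ShiftSet (γ l) (wv l) Λ ⊆ Λ') (bb : ι → ℂ) (yw : ι → List (Orb (PolySite Λ) × Bool))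
    {δ : Type*} (ah : Finset δ) (dc : δ → ℝ) (V : δ → FermionOp Λ')
    {κ'' : Type*} (w : Finset κ'') (a : κ'' → ℂ) (word : κ'' → List (Orb (PolySite Λ') × Bool))
    {β : Type*} [Fintype β] [DecidableEq β] {G : Matrix β β ℂ} (hG : G.PosSemidef) (Bk : β → FermionOp Λ) {c : ℝ}
    (hcert : Xw - (c : ℂ) • (1 : FermionOp Λ') -
        ∑ σ : Fin 2, ((μc σ : ℝ) : ℂ) • (nAt 0 hz σ - ((ν : ℝ) : ℂ) • (1 : FermionOp Λ')) -
        ((κp : ℝ) : ℂ) • (((u : ℝ) : ℂ) • (1 : FermionOp Λ') -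
          fermionEmbed (PolySite.incl h0) ((hubbardTTPrimeSourcedInteraction 1 t' U μ dWaveFormFactor h).meanEnergyObs 1)) -
        ((κm : ℝ) : ℂ) • (fermionEmbed (PolySite.incl h0) ((hubbardTTPrimeFermionInteraction 1 t' U).meanEnergyObs 1) -
          ((lo : ℝ) : ℂ) • (1 : FermionOp Λ')) =
      gramForm Λm O +
        (∑ k ∈ s, (pairSourceWindowHamiltonianTT' dWaveFormFactor Λ' t' U μ h * fermionEmbed (PolySite.incl hΛ) (B k) -
            fermionEmbed (PolySite.incl hΛ) (B k) * pairSourceWindowHamiltonianTT' dWaveFormFactor Λ' t' U μ h) +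
          ∑ l ∈ tt, bb l • (gaugePhase (twistFlipExp (γ l) (fl l) (mt l)) (yw l) •
              fermionEmbed (PolySite.incl (hsh l))
                (fermionEmbed (PolySite.d4Emb (γ l) (wv l) Λ) (spinSwapIter (fl l).val (ladderWord (yw l)))) -
            fermionEmbed (PolySite.incl hΛ) (ladderWord (yw l)))) +
        (∑ m' ∈ ah, ((dc m' : ℝ) : ℂ) • ((V m')ᴴ - V m') + ∑ k ∈ w, a k • ladderWord (word k)) +
        kktForm (pairSourceWindowHamiltonianTT' dWaveFormFactor Λ' t' U μ h) G
          (fun b' => fermionEmbed (PolySite.incl hΛ) (Bk b'))) :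
    c - ∑ k ∈ w, ‖a k‖ + (∑ σ : Fin 2, μc σ) * (ω.density / 2 - ν) ≤
      (∑ g : TwistFlipIndex, ((ω.twistedFlipAct g).expect Λ' Xw).re) / 32 := by
  -- the ground-state blocks
  set E : FermionOp Λ' := ∑ k ∈ s,
    (pairSourceWindowHamiltonianTT' dWaveFormFactor Λ' t' U μ h * fermionEmbed (PolySite.incl hΛ) (B k) -
      fermionEmbed (PolySite.incl hΛ) (B k) * pairSourceWindowHamiltonianTT' dWaveFormFactor Λ' t' U μ h) with hE
  set K : FermionOp Λ' := kktForm (pairSourceWindowHamiltonianTT' dWaveFormFactor Λ' t' U μ h) G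
    (fun b' => fermionEmbed (PolySite.incl hΛ) (Bk b')) with hK
  set D : FermionOp Λ' := ∑ l ∈ tt, bb l • (gaugePhase (twistFlipExp (γ l) (fl l) (mt l)) (yw l) •
      fermionEmbed (PolySite.incl (hsh l))
        (fermionEmbed (PolySite.d4Emb (γ l) (wv l) Λ) (spinSwapIter (fl l).val (ladderWord (yw l)))) -
    fermionEmbed (PolySite.incl hΛ) (ladderWord (yw l))) with hD
  set R : FermionOp Λ' := ∑ m' ∈ ah, ((dc m' : ℝ) : ℂ) • ((V m')ᴴ - V m') + ∑ k ∈ w, a k • ladderWord (word k) with hR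
  set N : FermionOp Λ' := ∑ σ : Fin 2, ((μc σ : ℝ) : ℂ) • (nAt 0 hz σ - ((ν : ℝ) : ℂ) • (1 : FermionOp Λ')) with hN
  set Cp : FermionOp Λ' := ((κp : ℝ) : ℂ) • (((u : ℝ) : ℂ) • (1 : FermionOp Λ') -
    fermionEmbed (PolySite.incl h0) ((hubbardTTPrimeSourcedInteraction 1 t' U μ dWaveFormFactor h).meanEnergyObs 1)) with hCp
  set Cm : FermionOp Λ' := ((κm : ℝ) : ℂ) • (fermionEmbed (PolySite.incl h0)
    ((hubbardTTPrimeFermionInteraction 1 t' U).meanEnergyObs 1) - ((lo : ℝ) : ℂ) • (1 : FermionOp Λ')) with hCm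
  -- move the ground-state blocks into the objective: the translation-invariant identity for `Xw − E − K`
  have hcert' : (Xw - E - K) - (c : ℂ) • (1 : FermionOp Λ') - N - Cp - Cm = gramForm Λm O + D + R := by
    have h1 : (Xw - E - K) - (c : ℂ) • (1 : FermionOp Λ') - N - Cp - Cm =
        (Xw - (c : ℂ) • (1 : FermionOp Λ') - N - Cp - Cm) - E - K := by abel
    rw [h1, hcert]
    abel
  have hmain := hmin.1.re_sum_twistedFlipAct_expect_ge_of_sourced_certificate t' U μ h hΛ h0 hz (Xw - E - K) κp κm u lo
    μc ν hcap hlo hΛm O tt γ wv fl mt hsh bb yw ah dc V w a word hcert'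
  -- in each transform (again a ground state) the `eom` block vanishes and the `kkt` block is nonnegative
  have hg : ∀ g : TwistFlipIndex,
      ((ω.twistedFlipAct g).expect Λ' (Xw - E - K)).re ≤ ((ω.twistedFlipAct g).expect Λ' Xw).re := by
    intro g
    have hming := hmin.twistedFlipAct g
    have hE0 : (ω.twistedFlipAct g).expect Λ' E = 0 :=
      hming.expect_sum_commutator_pairSourceWindowHamiltonianTT'_eq_zero hΛ h8 s B
    have hK0 : 0 ≤ ((ω.twistedFlipAct g).expect Λ' K).re :=
      hming.re_expect_kktForm_pairSourceWindowHamiltonianTT'_nonneg hΛ h8 hG Bk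
    rw [map_sub, map_sub, hE0, sub_zero, Complex.sub_re]
    linarith
  have hsum := Finset.sum_le_sum fun g (_ : g ∈ (Finset.univ : Finset TwistFlipIndex)) => hg g
  exact hmain.trans (div_le_div_of_nonneg_right hsum (by norm_num))

/-! ## §2 The node shapes on the ground-state class -/

/-- **Cap-row discharge on the class**: a translation-invariant minimiser carries the state-free sourced energy density,
`e^{src}_h(ω) = E(h) = dWaveSourceEnergyDensityTT' t' U μ h`; hence a certified `E(h) ≤ u` and `κ⁺ ≥ 0` give the cap-row
premise `κ⁺ e^{src}(ω) ≤ κ⁺ u`. [cite: BratteliKishimotoRobinson1978, Thm. 2 (condition 2)] -/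
theorem IsMeanEnergyMinimiser.mul_meanEnergy_sourced_le_of_le
    (hmin : ω.IsMeanEnergyMinimiser (hubbardTTPrimeSourcedInteraction 1 t' U μ dWaveFormFactor h) 1) {κp u : ℝ}
    (hκ : 0 ≤ κp) (hu : dWaveSourceEnergyDensityTT' t' U μ h ≤ u) :
    κp * ω.meanEnergy (hubbardTTPrimeSourcedInteraction 1 t' U μ dWaveFormFactor h) 1 ≤ κp * u := by
  refine mul_le_mul_of_nonneg_left ?_ hκ
  rw [hmin.meanEnergy_eq, tiGroundEnergyDensity_dWaveSourced_eq]
  exact hu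

/-- **ENERGY objective on the class** (`Xw = Γ E^{src}_h`): the identity with ground-state rows, filling rows, optional cap
(`κ⁺`, vacuous here) and floor (`κ⁻`, premise on the class of density `ρ(ω)`) rows proves
`c − Σ‖aₖ‖ + (Σ_σ μ_σ)(ρ(ω)/2 − ν) ≤ e^{src}_h(ω)` for every translation-invariant ground state `ω` of the sourced model.
[cite: WangEtAl2024, §III] [cite: BratteliKishimotoRobinson1978, Thm. 2] -/
theorem IsMeanEnergyMinimiser.le_meanEnergy_sourced_of_twistedFlip_certificate_kkt
    (hmin : ω.IsMeanEnergyMinimiser (hubbardTTPrimeSourcedInteraction 1 t' U μ dWaveFormFactor h) 1)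
    {Λ Λ' : Finset (Site 2)} (hΛ : Λ ⊆ Λ') (h8 : thicken Λ 1 ⊆ Λ') (h0 : thicken ({0} : Finset (Site 2)) 1 ⊆ Λ')
    (hz : (0 : Site 2) ∈ Λ') (κp κm u lo : ℝ) (μc : Fin 2 → ℝ) (ν : ℝ)
    (hcap : κp * ω.meanEnergy (hubbardTTPrimeSourcedInteraction 1 t' U μ dWaveFormFactor h) 1 ≤ κp * u)
    (hlo : ∀ σ : InfVolFermionState 2, σ.IsTranslationInvariant → σ.density = ω.density →
      κm * lo ≤ κm * σ.meanEnergy (hubbardTTPrimeFermionInteraction 1 t' U) 1)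
    {m : Type*} [Fintype m] [DecidableEq m] {Λm : Matrix m m ℂ} (hΛm : Λm.PosSemidef) (O : m → FermionOp Λ')
    {κ' : Type*} (s : Finset κ') (B : κ' → FermionOp Λ)
    {ι : Type*} (tt : Finset ι) (γ : ι → DihedralGroup 4) (wv : ι → Site 2) (fl mt : ι → Fin 2)
    (hsh : ∀ l, d4ShiftSet (γ l) (wv l) Λ ⊆ Λ') (bb : ι → ℂ) (yw : ι → List (Orb (PolySite Λ) × Bool))
    {δ : Type*} (ah : Finset δ) (dc : δ → ℝ) (V : δ → FermionOp Λ')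
    {κ'' : Type*} (w : Finset κ'') (a : κ'' → ℂ) (word : κ'' → List (Orb (PolySite Λ') × Bool))
    {β : Type*} [Fintype β] [DecidableEq β] {G : Matrix β β ℂ} (hG : G.PosSemidef) (Bk : β → FermionOp Λ) {c : ℝ}
    (hcert : fermionEmbed (PolySite.incl h0) ((hubbardTTPrimeSourcedInteraction 1 t' U μ dWaveFormFactor h).meanEnergyObs 1) -
        (c : ℂ) • (1 : FermionOp Λ') -
        ∑ σ : Fin 2, ((μc σ : ℝ) : ℂ) • (nAt 0 hz σ - ((ν : ℝ) : ℂ) • (1 : FermionOp Λ')) -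
        ((κp : ℝ) : ℂ) • (((u : ℝ) : ℂ) • (1 : FermionOp Λ') -
          fermionEmbed (PolySite.incl h0) ((hubbardTTPrimeSourcedInteraction 1 t' U μ dWaveFormFactor h).meanEnergyObs 1)) -
        ((κm : ℝ) : ℂ) • (fermionEmbed (PolySite.incl h0) ((hubbardTTPrimeFermionInteraction 1 t' U).meanEnergyObs 1) -
          ((lo : ℝ) : ℂ) • (1 : FermionOp Λ')) =
      gramForm Λm O +
        (∑ k ∈ s, (pairSourceWindowHamiltonianTT' dWaveFormFactor Λ' t' U μ h * fermionEmbed (PolySite.incl hΛ) (B k) -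
            fermionEmbed (PolySite.incl hΛ) (B k) * pairSourceWindowHamiltonianTT' dWaveFormFactor Λ' t' U μ h) +
          ∑ l ∈ tt, bb l • (gaugePhase (twistFlipExp (γ l) (fl l) (mt l)) (yw l) •
              fermionEmbed (PolySite.incl (hsh l))
                (fermionEmbed (PolySite.d4Emb (γ l) (wv l) Λ) (spinSwapIter (fl l).val (ladderWord (yw l)))) -
            fermionEmbed (PolySite.incl hΛ) (ladderWord (yw l)))) +
        (∑ m' ∈ ah, ((dc m' : ℝ) : ℂ) • ((V m')ᴴ - V m') + ∑ k ∈ w, a k • ladderWord (word k)) +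
        kktForm (pairSourceWindowHamiltonianTT' dWaveFormFactor Λ' t' U μ h) G
          (fun b' => fermionEmbed (PolySite.incl hΛ) (Bk b'))) :
    c - ∑ k ∈ w, ‖a k‖ + (∑ σ : Fin 2, μc σ) * (ω.density / 2 - ν) ≤
      ω.meanEnergy (hubbardTTPrimeSourcedInteraction 1 t' U μ dWaveFormFactor h) 1 := by
  have hmain := hmin.re_sum_twistedFlipAct_expect_ge_of_sourced_certificate_kkt hΛ h8 h0 hz _ κp κm u lo μc ν hcap hlo
    hΛm O s B tt γ wv fl mt hsh bb yw ah dc V w a word hG Bk hcert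
  have hE : ∀ g : TwistFlipIndex, ((ω.twistedFlipAct g).expect Λ'
      (fermionEmbed (PolySite.incl h0) ((hubbardTTPrimeSourcedInteraction 1 t' U μ dWaveFormFactor h).meanEnergyObs 1))).re =
      (ω.twistedFlipAct g).meanEnergy (hubbardTTPrimeSourcedInteraction 1 t' U μ dWaveFormFactor h) 1 := fun g => by
    rw [(ω.twistedFlipAct g).compatible h0, InfVolFermionState.meanEnergy]
  simp_rw [hE, hmin.1.sum_meanEnergy_hubbardTTPrimeSourced_twistedFlipAct] at hmain
  linarith

/-- **PAIR-AMPLITUDE MAX on the class** (`Xw = −(Γ P₀^d + (Γ P₀^d)ᴴ)`): the identity with ground-state rows, filling rows,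
the cap row `κ⁺ (u·1 − Γ E^{src}_h)` (on the class: `κ⁺ ≥ 0` and a certified `E(h) ≤ u`,
`IsMeanEnergyMinimiser.mul_meanEnergy_sourced_le_of_le`) and the optional floor row proves
`2 Re ω(P₀^d) ≤ −(c − Σ‖aₖ‖ + (Σ_σ μ_σ)(ρ(ω)/2 − ν))` for every translation-invariant ground state `ω` — a finite-`h`
RESPONSE ceiling on the class, not an order parameter. [cite: KomaTasaki1994, §1] [cite: WangEtAl2024, §III] -/
theorem IsMeanEnergyMinimiser.two_mul_re_expect_localPairAt_le_of_twistedFlip_certificate_kkt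
    (hmin : ω.IsMeanEnergyMinimiser (hubbardTTPrimeSourcedInteraction 1 t' U μ dWaveFormFactor h) 1)
    {Λ Λ' : Finset (Site 2)} (hΛ : Λ ⊆ Λ') (h8 : thicken Λ 1 ⊆ Λ') (h0 : thicken ({0} : Finset (Site 2)) 1 ⊆ Λ')
    (hz : (0 : Site 2) ∈ Λ') (hP : pairRegion (insert (0 : Site 2) unitSteps) 0 ⊆ Λ')
    (κp κm u lo : ℝ) (μc : Fin 2 → ℝ) (ν : ℝ)
    (hcap : κp * ω.meanEnergy (hubbardTTPrimeSourcedInteraction 1 t' U μ dWaveFormFactor h) 1 ≤ κp * u)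
    (hlo : ∀ σ : InfVolFermionState 2, σ.IsTranslationInvariant → σ.density = ω.density →
      κm * lo ≤ κm * σ.meanEnergy (hubbardTTPrimeFermionInteraction 1 t' U) 1)
    {m : Type*} [Fintype m] [DecidableEq m] {Λm : Matrix m m ℂ} (hΛm : Λm.PosSemidef) (O : m → FermionOp Λ')
    {κ' : Type*} (s : Finset κ') (B : κ' → FermionOp Λ)
    {ι : Type*} (tt : Finset ι) (γ : ι → DihedralGroup 4) (wv : ι → Site 2) (fl mt : ι → Fin 2)
    (hsh : ∀ l, d4ShiftSet (γ l) (wv l) Λ ⊆ Λ') (bb : ι → ℂ) (yw : ι → List (Orb (PolySite Λ) × Bool))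
    {δ : Type*} (ah : Finset δ) (dc : δ → ℝ) (V : δ → FermionOp Λ')
    {κ'' : Type*} (w : Finset κ'') (a : κ'' → ℂ) (word : κ'' → List (Orb (PolySite Λ') × Bool))
    {β : Type*} [Fintype β] [DecidableEq β] {G : Matrix β β ℂ} (hG : G.PosSemidef) (Bk : β → FermionOp Λ) {c : ℝ}
    (hcert : -(fermionEmbed (PolySite.incl hP) (localPairAt (insert (0 : Site 2) unitSteps) dWaveFormFactor 0) +
          (fermionEmbed (PolySite.incl hP) (localPairAt (insert (0 : Site 2) unitSteps) dWaveFormFactor 0))ᴴ) -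
        (c : ℂ) • (1 : FermionOp Λ') -
        ∑ σ : Fin 2, ((μc σ : ℝ) : ℂ) • (nAt 0 hz σ - ((ν : ℝ) : ℂ) • (1 : FermionOp Λ')) -
        ((κp : ℝ) : ℂ) • (((u : ℝ) : ℂ) • (1 : FermionOp Λ') -
          fermionEmbed (PolySite.incl h0) ((hubbardTTPrimeSourcedInteraction 1 t' U μ dWaveFormFactor h).meanEnergyObs 1)) -
        ((κm : ℝ) : ℂ) • (fermionEmbed (PolySite.incl h0) ((hubbardTTPrimeFermionInteraction 1 t' U).meanEnergyObs 1) -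
          ((lo : ℝ) : ℂ) • (1 : FermionOp Λ')) =
      gramForm Λm O +
        (∑ k ∈ s, (pairSourceWindowHamiltonianTT' dWaveFormFactor Λ' t' U μ h * fermionEmbed (PolySite.incl hΛ) (B k) -
            fermionEmbed (PolySite.incl hΛ) (B k) * pairSourceWindowHamiltonianTT' dWaveFormFactor Λ' t' U μ h) +
          ∑ l ∈ tt, bb l • (gaugePhase (twistFlipExp (γ l) (fl l) (mt l)) (yw l) •
              fermionEmbed (PolySite.incl (hsh l))
                (fermionEmbed (PolySite.d4Emb (γ l) (wv l) Λ) (spinSwapIter (fl l).val (ladderWord (yw l)))) -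
            fermionEmbed (PolySite.incl hΛ) (ladderWord (yw l)))) +
        (∑ m' ∈ ah, ((dc m' : ℝ) : ℂ) • ((V m')ᴴ - V m') + ∑ k ∈ w, a k • ladderWord (word k)) +
        kktForm (pairSourceWindowHamiltonianTT' dWaveFormFactor Λ' t' U μ h) G
          (fun b' => fermionEmbed (PolySite.incl hΛ) (Bk b'))) :
    2 * (ω.expect (pairRegion (insert (0 : Site 2) unitSteps) 0) (localPairAt (insert (0 : Site 2) unitSteps) dWaveFormFactor 0)).re ≤
      -(c - ∑ k ∈ w, ‖a k‖ + (∑ σ : Fin 2, μc σ) * (ω.density / 2 - ν)) := by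
  have hmain := hmin.re_sum_twistedFlipAct_expect_ge_of_sourced_certificate_kkt hΛ h8 h0 hz _ κp κm u lo μc ν hcap hlo
    hΛm O s B tt γ wv fl mt hsh bb yw ah dc V w a word hG Bk hcert
  simp_rw [map_neg, Complex.neg_re, re_expect_fermionEmbed_localPairAt_add_conjTranspose, Finset.sum_neg_distrib,
    ← Finset.mul_sum, ω.sum_re_expect_localPairAt_dWave_twistedFlipAct] at hmain
  linarith

/-- **PAIR-AMPLITUDE MIN on the class** (`Xw = +(Γ P₀^d + (Γ P₀^d)ᴴ)`): the identity with ground-state rows (the rows that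
make this program informative — census (38) of the cell), filling rows, cap and floor rows proves
`c − Σ‖aₖ‖ + (Σ_σ μ_σ)(ρ(ω)/2 − ν) ≤ 2 Re ω(P₀^d)` for every translation-invariant ground state `ω` of the sourced model at
`(μ, h)` — a finite-`h` response FLOOR on the ground-state class, not an order parameter. [cite: KomaTasaki1994, §1]
[cite: WangEtAl2024, §III] [cite: AraujoEtAl2023, §3.2 Prop. 11] -/
theorem IsMeanEnergyMinimiser.le_two_mul_re_expect_localPairAt_of_twistedFlip_certificate_kkt
    (hmin : ω.IsMeanEnergyMinimiser (hubbardTTPrimeSourcedInteraction 1 t' U μ dWaveFormFactor h) 1)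
    {Λ Λ' : Finset (Site 2)} (hΛ : Λ ⊆ Λ') (h8 : thicken Λ 1 ⊆ Λ') (h0 : thicken ({0} : Finset (Site 2)) 1 ⊆ Λ')
    (hz : (0 : Site 2) ∈ Λ') (hP : pairRegion (insert (0 : Site 2) unitSteps) 0 ⊆ Λ')
    (κp κm u lo : ℝ) (μc : Fin 2 → ℝ) (ν : ℝ)
    (hcap : κp * ω.meanEnergy (hubbardTTPrimeSourcedInteraction 1 t' U μ dWaveFormFactor h) 1 ≤ κp * u)
    (hlo : ∀ σ : InfVolFermionState 2, σ.IsTranslationInvariant → σ.density = ω.density →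
      κm * lo ≤ κm * σ.meanEnergy (hubbardTTPrimeFermionInteraction 1 t' U) 1)
    {m : Type*} [Fintype m] [DecidableEq m] {Λm : Matrix m m ℂ} (hΛm : Λm.PosSemidef) (O : m → FermionOp Λ')
    {κ' : Type*} (s : Finset κ') (B : κ' → FermionOp Λ)
    {ι : Type*} (tt : Finset ι) (γ : ι → DihedralGroup 4) (wv : ι → Site 2) (fl mt : ι → Fin 2)
    (hsh : ∀ l, d4ShiftSet (γ l) (wv l) Λ ⊆ Λ') (bb : ι → ℂ) (yw : ι → List (Orb (PolySite Λ) × Bool))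
    {δ : Type*} (ah : Finset δ) (dc : δ → ℝ) (V : δ → FermionOp Λ')
    {κ'' : Type*} (w : Finset κ'') (a : κ'' → ℂ) (word : κ'' → List (Orb (PolySite Λ') × Bool))
    {β : Type*} [Fintype β] [DecidableEq β] {G : Matrix β β ℂ} (hG : G.PosSemidef) (Bk : β → FermionOp Λ) {c : ℝ}
    (hcert : (fermionEmbed (PolySite.incl hP) (localPairAt (insert (0 : Site 2) unitSteps) dWaveFormFactor 0) +
          (fermionEmbed (PolySite.incl hP) (localPairAt (insert (0 : Site 2) unitSteps) dWaveFormFactor 0))ᴴ) -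
        (c : ℂ) • (1 : FermionOp Λ') -
        ∑ σ : Fin 2, ((μc σ : ℝ) : ℂ) • (nAt 0 hz σ - ((ν : ℝ) : ℂ) • (1 : FermionOp Λ')) -
        ((κp : ℝ) : ℂ) • (((u : ℝ) : ℂ) • (1 : FermionOp Λ') -
          fermionEmbed (PolySite.incl h0) ((hubbardTTPrimeSourcedInteraction 1 t' U μ dWaveFormFactor h).meanEnergyObs 1)) -
        ((κm : ℝ) : ℂ) • (fermionEmbed (PolySite.incl h0) ((hubbardTTPrimeFermionInteraction 1 t' U).meanEnergyObs 1) -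
          ((lo : ℝ) : ℂ) • (1 : FermionOp Λ')) =
      gramForm Λm O +
        (∑ k ∈ s, (pairSourceWindowHamiltonianTT' dWaveFormFactor Λ' t' U μ h * fermionEmbed (PolySite.incl hΛ) (B k) -
            fermionEmbed (PolySite.incl hΛ) (B k) * pairSourceWindowHamiltonianTT' dWaveFormFactor Λ' t' U μ h) +
          ∑ l ∈ tt, bb l • (gaugePhase (twistFlipExp (γ l) (fl l) (mt l)) (yw l) •
              fermionEmbed (PolySite.incl (hsh l))
                (fermionEmbed (PolySite.d4Emb (γ l) (wv l) Λ) (spinSwapIter (fl l).val (ladderWord (yw l)))) -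
            fermionEmbed (PolySite.incl hΛ) (ladderWord (yw l)))) +
        (∑ m' ∈ ah, ((dc m' : ℝ) : ℂ) • ((V m')ᴴ - V m') + ∑ k ∈ w, a k • ladderWord (word k)) +
        kktForm (pairSourceWindowHamiltonianTT' dWaveFormFactor Λ' t' U μ h) G
          (fun b' => fermionEmbed (PolySite.incl hΛ) (Bk b'))) :
    c - ∑ k ∈ w, ‖a k‖ + (∑ σ : Fin 2, μc σ) * (ω.density / 2 - ν) ≤
      2 * (ω.expect (pairRegion (insert (0 : Site 2) unitSteps) 0) (localPairAt (insert (0 : Site 2) unitSteps) dWaveFormFactor 0)).re := by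
  have hmain := hmin.re_sum_twistedFlipAct_expect_ge_of_sourced_certificate_kkt hΛ h8 h0 hz _ κp κm u lo μc ν hcap hlo
    hΛm O s B tt γ wv fl mt hsh bb yw ah dc V w a word hG Bk hcert
  simp_rw [re_expect_fermionEmbed_localPairAt_add_conjTranspose, ← Finset.mul_sum,
    ω.sum_re_expect_localPairAt_dWave_twistedFlipAct] at hmain
  linarith

/-! ## §3 State-free sentences (grand-canonical shapes) -/

/-- **ENERGY FLOOR, STATE-FREE**: a grand-canonical sourced energy certificate WITH ground-state rows (objective `Γ E^{src}_h`,
no filling rows, no energy rows; `eom` block, flip-twisted defects, `kkt` block) proves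
`c − Σ‖aₖ‖ ≤ E(h) = dWaveSourceEnergyDensityTT' t' U μ h`: the infimum over translation-invariant states is ATTAINED at a
translation-invariant ground state, where the ground-state rows are licensed. (The torus route to the same number is
`dWaveSourceTorusTT'_groundEnergy_ge_of_twistedFlip_window_certificate_kkt` + `dWaveSourceEnergyDensityTT'_ge_of_forall_le`.)
[cite: WangEtAl2024, §III] [cite: BratteliKishimotoRobinson1978, Thm. 2] -/
theorem dWaveSourceEnergyDensityTT'_ge_of_gs_certificate_kkt (t' U μ h : ℝ)
    {Λ Λ' : Finset (Site 2)} (hΛ : Λ ⊆ Λ') (h8 : thicken Λ 1 ⊆ Λ') (h0 : thicken ({0} : Finset (Site 2)) 1 ⊆ Λ')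
    {m : Type*} [Fintype m] [DecidableEq m] {Λm : Matrix m m ℂ} (hΛm : Λm.PosSemidef) (O : m → FermionOp Λ')
    {κ' : Type*} (s : Finset κ') (B : κ' → FermionOp Λ)
    {ι : Type*} (tt : Finset ι) (γ : ι → DihedralGroup 4) (wv : ι → Site 2) (fl mt : ι → Fin 2)
    (hsh : ∀ l, d4ShiftSet (γ l) (wv l) Λ ⊆ Λ') (bb : ι → ℂ) (yw : ι → List (Orb (PolySite Λ) × Bool))
    {δ : Type*} (ah : Finset δ) (dc : δ → ℝ) (V : δ → FermionOp Λ')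
    {κ'' : Type*} (w : Finset κ'') (a : κ'' → ℂ) (word : κ'' → List (Orb (PolySite Λ') × Bool))
    {β : Type*} [Fintype β] [DecidableEq β] {G : Matrix β β ℂ} (hG : G.PosSemidef) (Bk : β → FermionOp Λ) {c : ℝ}
    (hcert : fermionEmbed (PolySite.incl h0) ((hubbardTTPrimeSourcedInteraction 1 t' U μ dWaveFormFactor h).meanEnergyObs 1) -
        (c : ℂ) • (1 : FermionOp Λ') =
      gramForm Λm O +
        (∑ k ∈ s, (pairSourceWindowHamiltonianTT' dWaveFormFactor Λ' t' U μ h * fermionEmbed (PolySite.incl hΛ) (B k) -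
            fermionEmbed (PolySite.incl hΛ) (B k) * pairSourceWindowHamiltonianTT' dWaveFormFactor Λ' t' U μ h) +
          ∑ l ∈ tt, bb l • (gaugePhase (twistFlipExp (γ l) (fl l) (mt l)) (yw l) •
              fermionEmbed (PolySite.incl (hsh l))
                (fermionEmbed (PolySite.d4Emb (γ l) (wv l) Λ) (spinSwapIter (fl l).val (ladderWord (yw l)))) -
            fermionEmbed (PolySite.incl hΛ) (ladderWord (yw l)))) +
        (∑ m' ∈ ah, ((dc m' : ℝ) : ℂ) • ((V m')ᴴ - V m') + ∑ k ∈ w, a k • ladderWord (word k)) +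
        kktForm (pairSourceWindowHamiltonianTT' dWaveFormFactor Λ' t' U μ h) G
          (fun b' => fermionEmbed (PolySite.incl hΛ) (Bk b'))) :
    c - ∑ k ∈ w, ‖a k‖ ≤ dWaveSourceEnergyDensityTT' t' U μ h := by
  -- a translation-invariant ground state exists and carries `E(h)`
  obtain ⟨ω₀, hω₀, hω₀e⟩ := exists_re_expect_eq_dWaveSourceEnergyDensityTT' t' U μ h
  have hmin : ω₀.IsMeanEnergyMinimiser (hubbardTTPrimeSourcedInteraction 1 t' U μ dWaveFormFactor h) 1 :=
    (isMeanEnergyMinimiser_dWaveSourced_iff t' U μ h ω₀).2 ⟨hω₀, hω₀e.le⟩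
  have hz : (0 : Site 2) ∈ Λ' := h0 (subset_thicken _ _ (Finset.mem_singleton_self 0))
  -- the identity with all linear rows absent
  have hcert' : fermionEmbed (PolySite.incl h0) ((hubbardTTPrimeSourcedInteraction 1 t' U μ dWaveFormFactor h).meanEnergyObs 1) -
        (c : ℂ) • (1 : FermionOp Λ') -
        ∑ σ : Fin 2, (((0 : ℝ) : ℝ) : ℂ) • (nAt 0 hz σ - (((0 : ℝ) : ℝ) : ℂ) • (1 : FermionOp Λ')) -
        (((0 : ℝ) : ℝ) : ℂ) • ((((0 : ℝ) : ℝ) : ℂ) • (1 : FermionOp Λ') -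
          fermionEmbed (PolySite.incl h0) ((hubbardTTPrimeSourcedInteraction 1 t' U μ dWaveFormFactor h).meanEnergyObs 1)) -
        (((0 : ℝ) : ℝ) : ℂ) • (fermionEmbed (PolySite.incl h0) ((hubbardTTPrimeFermionInteraction 1 t' U).meanEnergyObs 1) -
          (((0 : ℝ) : ℝ) : ℂ) • (1 : FermionOp Λ')) =
      gramForm Λm O +
        (∑ k ∈ s, (pairSourceWindowHamiltonianTT' dWaveFormFactor Λ' t' U μ h * fermionEmbed (PolySite.incl hΛ) (B k) -
            fermionEmbed (PolySite.incl hΛ) (B k) * pairSourceWindowHamiltonianTT' dWaveFormFactor Λ' t' U μ h) +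
          ∑ l ∈ tt, bb l • (gaugePhase (twistFlipExp (γ l) (fl l) (mt l)) (yw l) •
              fermionEmbed (PolySite.incl (hsh l))
                (fermionEmbed (PolySite.d4Emb (γ l) (wv l) Λ) (spinSwapIter (fl l).val (ladderWord (yw l)))) -
            fermionEmbed (PolySite.incl hΛ) (ladderWord (yw l)))) +
        (∑ m' ∈ ah, ((dc m' : ℝ) : ℂ) • ((V m')ᴴ - V m') + ∑ k ∈ w, a k • ladderWord (word k)) +
        kktForm (pairSourceWindowHamiltonianTT' dWaveFormFactor Λ' t' U μ h) G
          (fun b' => fermionEmbed (PolySite.incl hΛ) (Bk b')) := by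
    simp only [Complex.ofReal_zero, zero_smul, Finset.sum_const_zero, sub_zero]
    exact hcert
  have hmain := hmin.le_meanEnergy_sourced_of_twistedFlip_certificate_kkt hΛ h8 h0 hz 0 0 0 0 (fun _ => 0) 0
    (by simp only [zero_mul, le_refl]) (fun _ _ _ => by simp only [zero_mul, le_refl]) hΛm O s B tt γ wv fl mt hsh bb yw
    ah dc V w a word hG Bk hcert'
  rw [hmin.meanEnergy_eq, tiGroundEnergyDensity_dWaveSourced_eq] at hmain
  simpa using hmain

/-- **RESPONSE FLOOR ON `−∂⁻E(h)`, STATE-FREE**: a grand-canonical pair-amplitude MIN certificate WITH ground-state rows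
(objective `Γ P₀^d + (Γ P₀^d)ᴴ`, no filling rows, a cap row `κ⁺ (u·1 − Γ E^{src}_h)` with `κ⁺ ≥ 0` and a certified
`E(h) ≤ u`, no unsourced floor row) proves `c − Σ‖aₖ‖ ≤ −∂⁻E(h)` — the smallest induced pair amplitude `2 Re ω(P₀^d)` over
the translation-invariant ground states at field `h`, ATTAINED in the class (Griffiths' interval; tree
`exists_isMeanEnergyMinimiser_two_mul_re_expect_localPairAt_eq_neg_leftDeriv`). A finite-`h` response floor, not an order
parameter. [cite: Griffiths1966, §II] [cite: KomaTasaki1994, §1] [cite: WangEtAl2024, §III] -/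
theorem neg_leftDeriv_dWaveSourceEnergyDensityTT'_ge_of_gs_certificate_kkt (t' U μ h : ℝ)
    {Λ Λ' : Finset (Site 2)} (hΛ : Λ ⊆ Λ') (h8 : thicken Λ 1 ⊆ Λ') (h0 : thicken ({0} : Finset (Site 2)) 1 ⊆ Λ')
    (hP : pairRegion (insert (0 : Site 2) unitSteps) 0 ⊆ Λ') {κp u : ℝ} (hκ : 0 ≤ κp)
    (hu : dWaveSourceEnergyDensityTT' t' U μ h ≤ u)
    {m : Type*} [Fintype m] [DecidableEq m] {Λm : Matrix m m ℂ} (hΛm : Λm.PosSemidef) (O : m → FermionOp Λ')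
    {κ' : Type*} (s : Finset κ') (B : κ' → FermionOp Λ)
    {ι : Type*} (tt : Finset ι) (γ : ι → DihedralGroup 4) (wv : ι → Site 2) (fl mt : ι → Fin 2)
    (hsh : ∀ l, d4ShiftSet (γ l) (wv l) Λ ⊆ Λ') (bb : ι → ℂ) (yw : ι → List (Orb (PolySite Λ) × Bool))
    {δ : Type*} (ah : Finset δ) (dc : δ → ℝ) (V : δ → FermionOp Λ')
    {κ'' : Type*} (w : Finset κ'') (a : κ'' → ℂ) (word : κ'' → List (Orb (PolySite Λ') × Bool))
    {β : Type*} [Fintype β] [DecidableEq β] {G : Matrix β β ℂ} (hG : G.PosSemidef) (Bk : β → FermionOp Λ) {c : ℝ}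
    (hcert : (fermionEmbed (PolySite.incl hP) (localPairAt (insert (0 : Site 2) unitSteps) dWaveFormFactor 0) +
          (fermionEmbed (PolySite.incl hP) (localPairAt (insert (0 : Site 2) unitSteps) dWaveFormFactor 0))ᴴ) -
        (c : ℂ) • (1 : FermionOp Λ') -
        ((κp : ℝ) : ℂ) • (((u : ℝ) : ℂ) • (1 : FermionOp Λ') -
          fermionEmbed (PolySite.incl h0) ((hubbardTTPrimeSourcedInteraction 1 t' U μ dWaveFormFactor h).meanEnergyObs 1)) =
      gramForm Λm O +
        (∑ k ∈ s, (pairSourceWindowHamiltonianTT' dWaveFormFactor Λ' t' U μ h * fermionEmbed (PolySite.incl hΛ) (B k) -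
            fermionEmbed (PolySite.incl hΛ) (B k) * pairSourceWindowHamiltonianTT' dWaveFormFactor Λ' t' U μ h) +
          ∑ l ∈ tt, bb l • (gaugePhase (twistFlipExp (γ l) (fl l) (mt l)) (yw l) •
              fermionEmbed (PolySite.incl (hsh l))
                (fermionEmbed (PolySite.d4Emb (γ l) (wv l) Λ) (spinSwapIter (fl l).val (ladderWord (yw l)))) -
            fermionEmbed (PolySite.incl hΛ) (ladderWord (yw l)))) +
        (∑ m' ∈ ah, ((dc m' : ℝ) : ℂ) • ((V m')ᴴ - V m') + ∑ k ∈ w, a k • ladderWord (word k)) +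
        kktForm (pairSourceWindowHamiltonianTT' dWaveFormFactor Λ' t' U μ h) G
          (fun b' => fermionEmbed (PolySite.incl hΛ) (Bk b'))) :
    c - ∑ k ∈ w, ‖a k‖ ≤ -derivWithin (dWaveSourceEnergyDensityTT' t' U μ) (Iio h) h := by
  -- the ground state realising the lower end of Griffiths' interval
  obtain ⟨ω₀, hmin, hω₀⟩ := exists_isMeanEnergyMinimiser_two_mul_re_expect_localPairAt_eq_neg_leftDeriv t' U μ h
  have hz : (0 : Site 2) ∈ Λ' := h0 (subset_thicken _ _ (Finset.mem_singleton_self 0))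
  have hcert' : (fermionEmbed (PolySite.incl hP) (localPairAt (insert (0 : Site 2) unitSteps) dWaveFormFactor 0) +
          (fermionEmbed (PolySite.incl hP) (localPairAt (insert (0 : Site 2) unitSteps) dWaveFormFactor 0))ᴴ) -
        (c : ℂ) • (1 : FermionOp Λ') -
        ∑ σ : Fin 2, (((0 : ℝ) : ℝ) : ℂ) • (nAt 0 hz σ - (((0 : ℝ) : ℝ) : ℂ) • (1 : FermionOp Λ')) -
        ((κp : ℝ) : ℂ) • (((u : ℝ) : ℂ) • (1 : FermionOp Λ') -
          fermionEmbed (PolySite.incl h0) ((hubbardTTPrimeSourcedInteraction 1 t' U μ dWaveFormFactor h).meanEnergyObs 1)) -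
        (((0 : ℝ) : ℝ) : ℂ) • (fermionEmbed (PolySite.incl h0) ((hubbardTTPrimeFermionInteraction 1 t' U).meanEnergyObs 1) -
          (((0 : ℝ) : ℝ) : ℂ) • (1 : FermionOp Λ')) =
      gramForm Λm O +
        (∑ k ∈ s, (pairSourceWindowHamiltonianTT' dWaveFormFactor Λ' t' U μ h * fermionEmbed (PolySite.incl hΛ) (B k) -
            fermionEmbed (PolySite.incl hΛ) (B k) * pairSourceWindowHamiltonianTT' dWaveFormFactor Λ' t' U μ h) +
          ∑ l ∈ tt, bb l • (gaugePhase (twistFlipExp (γ l) (fl l) (mt l)) (yw l) •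
              fermionEmbed (PolySite.incl (hsh l))
                (fermionEmbed (PolySite.d4Emb (γ l) (wv l) Λ) (spinSwapIter (fl l).val (ladderWord (yw l)))) -
            fermionEmbed (PolySite.incl hΛ) (ladderWord (yw l)))) +
        (∑ m' ∈ ah, ((dc m' : ℝ) : ℂ) • ((V m')ᴴ - V m') + ∑ k ∈ w, a k • ladderWord (word k)) +
        kktForm (pairSourceWindowHamiltonianTT' dWaveFormFactor Λ' t' U μ h) G
          (fun b' => fermionEmbed (PolySite.incl hΛ) (Bk b')) := by
    simp only [Complex.ofReal_zero, zero_smul, Finset.sum_const_zero, sub_zero]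
    exact hcert
  have hmain := hmin.le_two_mul_re_expect_localPairAt_of_twistedFlip_certificate_kkt hΛ h8 h0 hz hP κp 0 u 0 (fun _ => 0) 0
    (hmin.mul_meanEnergy_sourced_le_of_le hκ hu) (fun _ _ _ => by simp only [zero_mul, le_refl]) hΛm O s B tt γ wv fl mt
    hsh bb yw ah dc V w a word hG Bk hcert'
  rw [hω₀] at hmain
  simpa using hmain

/-- **RESPONSE CEILING ON `−∂⁺E(h)`, STATE-FREE**: a grand-canonical pair-amplitude MAX certificate WITH ground-state rows
(objective `−(Γ P₀^d + (Γ P₀^d)ᴴ)`, no filling rows, cap row with `κ⁺ ≥ 0` and certified `E(h) ≤ u`) proves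
`−∂⁺E(h) ≤ −(c − Σ‖aₖ‖)` — the largest induced pair amplitude over the translation-invariant ground states at field `h`
(attained, tree `exists_isMeanEnergyMinimiser_two_mul_re_expect_localPairAt_eq_neg_rightDeriv`). A finite-`h` response
ceiling, not an order parameter. [cite: Griffiths1966, §II] [cite: KomaTasaki1994, §1] [cite: WangEtAl2024, §III] -/
theorem neg_rightDeriv_dWaveSourceEnergyDensityTT'_le_of_gs_certificate_kkt (t' U μ h : ℝ)
    {Λ Λ' : Finset (Site 2)} (hΛ : Λ ⊆ Λ') (h8 : thicken Λ 1 ⊆ Λ') (h0 : thicken ({0} : Finset (Site 2)) 1 ⊆ Λ')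
    (hP : pairRegion (insert (0 : Site 2) unitSteps) 0 ⊆ Λ') {κp u : ℝ} (hκ : 0 ≤ κp)
    (hu : dWaveSourceEnergyDensityTT' t' U μ h ≤ u)
    {m : Type*} [Fintype m] [DecidableEq m] {Λm : Matrix m m ℂ} (hΛm : Λm.PosSemidef) (O : m → FermionOp Λ')
    {κ' : Type*} (s : Finset κ') (B : κ' → FermionOp Λ)
    {ι : Type*} (tt : Finset ι) (γ : ι → DihedralGroup 4) (wv : ι → Site 2) (fl mt : ι → Fin 2)
    (hsh : ∀ l, d4ShiftSet (γ l) (wv l) Λ ⊆ Λ') (bb : ι → ℂ) (yw : ι → List (Orb (PolySite Λ) × Bool))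
    {δ : Type*} (ah : Finset δ) (dc : δ → ℝ) (V : δ → FermionOp Λ')
    {κ'' : Type*} (w : Finset κ'') (a : κ'' → ℂ) (word : κ'' → List (Orb (PolySite Λ') × Bool))
    {β : Type*} [Fintype β] [DecidableEq β] {G : Matrix β β ℂ} (hG : G.PosSemidef) (Bk : β → FermionOp Λ) {c : ℝ}
    (hcert : -(fermionEmbed (PolySite.incl hP) (localPairAt (insert (0 : Site 2) unitSteps) dWaveFormFactor 0) +
          (fermionEmbed (PolySite.incl hP) (localPairAt (insert (0 : Site 2) unitSteps) dWaveFormFactor 0))ᴴ) -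
        (c : ℂ) • (1 : FermionOp Λ') -
        ((κp : ℝ) : ℂ) • (((u : ℝ) : ℂ) • (1 : FermionOp Λ') -
          fermionEmbed (PolySite.incl h0) ((hubbardTTPrimeSourcedInteraction 1 t' U μ dWaveFormFactor h).meanEnergyObs 1)) =
      gramForm Λm O +
        (∑ k ∈ s, (pairSourceWindowHamiltonianTT' dWaveFormFactor Λ' t' U μ h * fermionEmbed (PolySite.incl hΛ) (B k) -
            fermionEmbed (PolySite.incl hΛ) (B k) * pairSourceWindowHamiltonianTT' dWaveFormFactor Λ' t' U μ h) +
          ∑ l ∈ tt, bb l • (gaugePhase (twistFlipExp (γ l) (fl l) (mt l)) (yw l) •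
              fermionEmbed (PolySite.incl (hsh l))
                (fermionEmbed (PolySite.d4Emb (γ l) (wv l) Λ) (spinSwapIter (fl l).val (ladderWord (yw l)))) -
            fermionEmbed (PolySite.incl hΛ) (ladderWord (yw l)))) +
        (∑ m' ∈ ah, ((dc m' : ℝ) : ℂ) • ((V m')ᴴ - V m') + ∑ k ∈ w, a k • ladderWord (word k)) +
        kktForm (pairSourceWindowHamiltonianTT' dWaveFormFactor Λ' t' U μ h) G
          (fun b' => fermionEmbed (PolySite.incl hΛ) (Bk b'))) :
    -derivWithin (dWaveSourceEnergyDensityTT' t' U μ) (Ioi h) h ≤ -(c - ∑ k ∈ w, ‖a k‖) := by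
  obtain ⟨ω₀, hmin, hω₀⟩ := exists_isMeanEnergyMinimiser_two_mul_re_expect_localPairAt_eq_neg_rightDeriv t' U μ h
  have hz : (0 : Site 2) ∈ Λ' := h0 (subset_thicken _ _ (Finset.mem_singleton_self 0))
  have hcert' : -(fermionEmbed (PolySite.incl hP) (localPairAt (insert (0 : Site 2) unitSteps) dWaveFormFactor 0) +
          (fermionEmbed (PolySite.incl hP) (localPairAt (insert (0 : Site 2) unitSteps) dWaveFormFactor 0))ᴴ) -
        (c : ℂ) • (1 : FermionOp Λ') -
        ∑ σ : Fin 2, (((0 : ℝ) : ℝ) : ℂ) • (nAt 0 hz σ - (((0 : ℝ) : ℝ) : ℂ) • (1 : FermionOp Λ')) -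
        ((κp : ℝ) : ℂ) • (((u : ℝ) : ℂ) • (1 : FermionOp Λ') -
          fermionEmbed (PolySite.incl h0) ((hubbardTTPrimeSourcedInteraction 1 t' U μ dWaveFormFactor h).meanEnergyObs 1)) -
        (((0 : ℝ) : ℝ) : ℂ) • (fermionEmbed (PolySite.incl h0) ((hubbardTTPrimeFermionInteraction 1 t' U).meanEnergyObs 1) -
          (((0 : ℝ) : ℝ) : ℂ) • (1 : FermionOp Λ')) =
      gramForm Λm O +
        (∑ k ∈ s, (pairSourceWindowHamiltonianTT' dWaveFormFactor Λ' t' U μ h * fermionEmbed (PolySite.incl hΛ) (B k) -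
            fermionEmbed (PolySite.incl hΛ) (B k) * pairSourceWindowHamiltonianTT' dWaveFormFactor Λ' t' U μ h) +
          ∑ l ∈ tt, bb l • (gaugePhase (twistFlipExp (γ l) (fl l) (mt l)) (yw l) •
              fermionEmbed (PolySite.incl (hsh l))
                (fermionEmbed (PolySite.d4Emb (γ l) (wv l) Λ) (spinSwapIter (fl l).val (ladderWord (yw l)))) -
            fermionEmbed (PolySite.incl hΛ) (ladderWord (yw l)))) +
        (∑ m' ∈ ah, ((dc m' : ℝ) : ℂ) • ((V m')ᴴ - V m') + ∑ k ∈ w, a k • ladderWord (word k)) +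
        kktForm (pairSourceWindowHamiltonianTT' dWaveFormFactor Λ' t' U μ h) G
          (fun b' => fermionEmbed (PolySite.incl hΛ) (Bk b')) := by
    simp only [Complex.ofReal_zero, zero_smul, Finset.sum_const_zero, sub_zero]
    exact hcert
  have hmain := hmin.two_mul_re_expect_localPairAt_le_of_twistedFlip_certificate_kkt hΛ h8 h0 hz hP κp 0 u 0 (fun _ => 0) 0
    (hmin.mul_meanEnergy_sourced_le_of_le hκ hu) (fun _ _ _ => by simp only [zero_mul, le_refl]) hΛm O s B tt γ wv fl mt
    hsh bb yw ah dc V w a word hG Bk hcert'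
  rw [hω₀] at hmain
  simpa using hmain

end InfVolFermionState

end Literature.MathematicalPhysics.QuantumLattice

end
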